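import Mathlib.Analysis.SpecialFunctions.Integrals.Basic
import HarnessLib

/-!
# Route `FordMaynardSieveConst01651`, target `SieveConst01651` (stmt-Parity-19185), stub `stub_certValuePos` (R2):
# log-free brackets for `∫ du/u` over a grid interval (tangent line and chord of `1/u`)

Def-free helper file for the soundness of the rectangle sums `certP` / `certN` of `…BuchstabCert`: on a rectangle
`[u₀, u₀+S] × [v₀, v₀+T]` the certificate bounds `∫∫ du dv/(uv)` from below by `4ST/((2u₀+S)(2v₀+T))` (midpoint tangent
of the convex `1/u`, i.e. `HM ≤ LM`) and from above by `ST(2u₀+S)(2v₀+T)/(4u₀v₀(u₀+S)(v₀+T))` (chord, `LM ≤ AM`), with no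
logarithm evaluated.  Here the one-dimensional facts:

* `inv_ge_tangent` — `1/u ≥ (2m − u)/m²` (`m > 0`); `inv_le_chord` — `1/u ≤ (a + b − u)/(ab)` on `[a, b]`, `0 < a`;
* `integral_inv_ge_tangent` — `2S/(2u₀+S) ≤ ∫_{u₀}^{u₀+S} du/u`;
* `integral_inv_le_chord` — `∫_{u₀}^{u₀+S} du/u ≤ S(2u₀+S)/(2u₀(u₀+S))`.

References: folklore (Hermite–Hadamard for the convex function `1/u`).
-/

noncomputable section

open MeasureTheory Set intervalIntegral

namespace Summit.Parity.GeneralizedHardyLittlewood.FordMaynardSieveConst01651SieveConst01651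

/-- A linear function integrates in closed form: `∫_{a}^{b} (c − k u) du = c(b−a) − k(b²−a²)/2`. [folklore] -/
theorem integral_linear (a b c k : ℝ) : ∫ u in a..b, (c - k * u) = c * (b - a) - k * ((b ^ 2 - a ^ 2) / 2) := by
  have hk : IntervalIntegrable (fun u : ℝ => k * u) volume a b :=
    (by fun_prop : Continuous (fun u : ℝ => k * u)).intervalIntegrable a b
  rw [intervalIntegral.integral_sub intervalIntegrable_const hk,
    intervalIntegral.integral_const, intervalIntegral.integral_const_mul, integral_id, smul_eq_mul]
  ring

/-- Tangent line of `1/u` at the midpoint lies below: with `w = 2u₀ + S > 0`, `4(w − u)/w² ≤ 1/u` for `u > 0`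
(`4u(w−u) ≤ w²`). [folklore] -/
theorem inv_ge_tangent {w u : ℝ} (hw : 0 < w) (hu : 0 < u) : 4 * (w - u) / w ^ 2 ≤ 1 / u := by
  rw [div_le_div_iff₀ (by positivity) hu]
  nlinarith [sq_nonneg (w - 2 * u)]

/-- Chord of `1/u` over `[a, b]` (`0 < a`) lies above: `1/u ≤ (a + b − u)/(ab)` for `a ≤ u ≤ b`. [folklore] -/
theorem inv_le_chord {a b u : ℝ} (ha : 0 < a) (hau : a ≤ u) (hub : u ≤ b) : 1 / u ≤ (a + b - u) / (a * b) := by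
  have hu : 0 < u := lt_of_lt_of_le ha hau
  have hb : 0 < b := lt_of_lt_of_le hu hub
  rw [div_le_div_iff₀ hu (by positivity)]
  nlinarith [mul_nonneg (sub_nonneg.2 hau) (sub_nonneg.2 hub)]

/-- `1/u` is interval integrable on `[u₀, u₀ + S]` for `u₀ > 0`, `S ≥ 0`. [folklore] -/
theorem intervalIntegrable_inv_grid {u₀ S : ℝ} (hu : 0 < u₀) (hS : 0 ≤ S) :
    IntervalIntegrable (fun u : ℝ => 1 / u) volume u₀ (u₀ + S) :=
  intervalIntegral.intervalIntegrable_one_div (fun u hu' => by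
    rw [Set.uIcc_of_le (by linarith : u₀ ≤ u₀ + S)] at hu'; linarith [hu'.1]) continuousOn_id

/-- **Tangent (midpoint) lower bound**: `2S/(2u₀+S) ≤ ∫_{u₀}^{u₀+S} du/u` for `u₀ > 0`, `S ≥ 0`. [folklore] -/
theorem integral_inv_ge_tangent {u₀ S : ℝ} (hu : 0 < u₀) (hS : 0 ≤ S) :
    2 * S / (2 * u₀ + S) ≤ ∫ u in u₀..(u₀ + S), 1 / u := by
  have hw : 0 < 2 * u₀ + S := by positivity
  have hle : u₀ ≤ u₀ + S := by linarith
  have hlin : ∫ u in u₀..(u₀ + S), 4 * (2 * u₀ + S - u) / (2 * u₀ + S) ^ 2 = 2 * S / (2 * u₀ + S) := by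
    have : (fun u : ℝ => 4 * (2 * u₀ + S - u) / (2 * u₀ + S) ^ 2) =
        fun u => 4 / (2 * u₀ + S) - (4 / (2 * u₀ + S) ^ 2) * u := by
      funext u; field_simp; try ring
    rw [this, integral_linear]
    field_simp
    try ring
  rw [← hlin]
  exact intervalIntegral.integral_mono_on hle ((by fun_prop : Continuous fun u : ℝ =>
      4 * (2 * u₀ + S - u) / (2 * u₀ + S) ^ 2).intervalIntegrable _ _) (intervalIntegrable_inv_grid hu hS)
    fun u hu' => inv_ge_tangent hw (by linarith [hu'.1])

/-- **Chord upper bound**: `∫_{u₀}^{u₀+S} du/u ≤ S(2u₀+S)/(2u₀(u₀+S))` for `u₀ > 0`, `S ≥ 0`. [folklore] -/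
theorem integral_inv_le_chord {u₀ S : ℝ} (hu : 0 < u₀) (hS : 0 ≤ S) :
    ∫ u in u₀..(u₀ + S), 1 / u ≤ S * (2 * u₀ + S) / (2 * u₀ * (u₀ + S)) := by
  have hle : u₀ ≤ u₀ + S := by linarith
  have hb : 0 < u₀ + S := by linarith
  have hlin : ∫ u in u₀..(u₀ + S), (u₀ + (u₀ + S) - u) / (u₀ * (u₀ + S)) =
      S * (2 * u₀ + S) / (2 * u₀ * (u₀ + S)) := by
    have : (fun u : ℝ => (u₀ + (u₀ + S) - u) / (u₀ * (u₀ + S))) =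
        fun u => (2 * u₀ + S) / (u₀ * (u₀ + S)) - (1 / (u₀ * (u₀ + S))) * u := by
      funext u; field_simp; try ring
    rw [this, integral_linear]
    field_simp
    try ring
  rw [← hlin]
  exact intervalIntegral.integral_mono_on hle (intervalIntegrable_inv_grid hu hS)
    ((by fun_prop : Continuous fun u : ℝ => (u₀ + (u₀ + S) - u) / (u₀ * (u₀ + S))).intervalIntegrable _ _)
    fun u hu' => inv_le_chord hu hu'.1 hu'.2

end Summit.Parity.GeneralizedHardyLittlewood.FordMaynardSieveConst01651SieveConst01651

end
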